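import Mathlib
import HarnessLib

/-!
# Allocating forward and reverse evolutions: the Cauchy–Schwarz floor of Bennett's two-sample variance

HONEST FRAMING: exact (Metropolis-corrected) sampling algorithms for lattice gauge theory;
figures of merit are autocorrelation/cost numbers at stated couplings and volumes; no
continuum-physics claim.

Venture `LatticeQCDFlow` (cell pub-lqcd), topic `Exactness`; FANOUT row 13 (`eng-snf`, GEN-14).
NEW WORK of the cell (elementary: one Cauchy–Schwarz step), not a published result; nothing is
cited as a fact (C. H. Bennett 1976 named only).  Companion of `NCMCGeneralSpaceTwoSampleBlocksCLT.lean`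
(GEN-14): there the asymptotic variance of the two-sample estimate from `a·n` forward and `b·n` reverse
independent evolutions is Bennett's functional `V_{a,b}(α) = v_F/a + v_R/b` per block, with
`v_F = E_F[(αe^{−W})²]/E_F[αe^{−W}]² − 1` and `v_R = E_R[α²]/E_R[α]² − 1` the squared coefficients of
variation of the two legs' weights.  THIS file answers the design question the engine's two-sided
mode faces: how to split a budget between the legs.

## Content (pure real analysis; `v_F, v_R ≥ 0` variances, `c_F, c_R > 0` costs per evolution, `a, b > 0` leg sizes)

* **`div_add_div_mul_cost_ge`** — THE FLOOR: `(v_F/a + v_R/b) · (c_F a + c_R b) ≥ (√(v_F c_F) + √(v_R c_R))²`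
  (Cauchy–Schwarz: the defect is `(√(v_F c_R b/a) − √(v_R c_F a/b))²`-shaped); hence for a budget
  `c_F a + c_R b ≤ C`: **`div_add_div_ge_of_cost_le`** — `v_F/a + v_R/b ≥ (√(v_F c_F) + √(v_R c_R))²/C`.
* **`div_add_div_eq_of_alloc`** — THE FLOOR IS ATTAINED by the allocation
  `a = t √(v_F/c_F)`, `b = t √(v_R/c_R)` (`t > 0`, `v_F, v_R > 0`): then
  `(v_F/a + v_R/b) · (c_F a + c_R b) = (√(v_F c_F) + √(v_R c_R))²`.
* Equal costs (`c_F = c_R = 1`, a budget of `a + b` evolutions per block):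
  **`div_add_div_mul_add_ge`** — `(v_F/a + v_R/b)(a + b) ≥ (√v_F + √v_R)²`.
  Reading for the engine (`estimators.bar` / `twosided`, choosing `n_forward : n_reverse`): with
  per-evolution costs `c_F, c_R` and leg variances `v_F = 1/ESS_F − 1`, `v_R = 1/ESS_R − 1` (squared
  coefficients of variation of the forward weights `αe^{−W}` and of `α` on the reverse leg), the
  variance-times-cost product of ANY split is at least `(√(v_F c_F) + √(v_R c_R))²`, attained at
  `n_F : n_R = √(v_F/c_F) : √(v_R/c_R)` — sample each leg in proportion to its weight CV over the root
  of its cost; an equal split can cost up to a factor `2` when one leg dominates.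

Scope / NOT CLAIMED: population variances and costs are INPUTS (no plug-in); integrality of leg
sizes ignored (real relaxation); the statistic `α` is fixed (the joint optimisation over `α` and the
split — Bennett's full problem — is not treated); no value for any concrete protocol.
-/

namespace Summit.Ventures.LatticeQCDFlow.Exactness.GeneralNCMC

open Real

/-- **Cauchy–Schwarz floor for the two-leg variance-cost product**: for `v_F, v_R ≥ 0`,
`c_F, c_R > 0` and leg sizes `a, b > 0`,
`(√(v_F c_F) + √(v_R c_R))² ≤ (v_F/a + v_R/b) · (c_F a + c_R b)`. -/
theorem div_add_div_mul_cost_ge {vF vR cF cR a b : ℝ} (hvF : 0 ≤ vF) (hvR : 0 ≤ vR)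
    (hcF : 0 < cF) (hcR : 0 < cR) (ha : 0 < a) (hb : 0 < b) :
    (√(vF * cF) + √(vR * cR)) ^ 2 ≤ (vF / a + vR / b) * (cF * a + cR * b) := by
  -- `x = √(v_F/a)`, `p = √(c_F a)`, `y = √(v_R/b)`, `q = √(c_R b)`; `xp = √(v_F c_F)`, `yq = √(v_R c_R)`
  set x := √(vF / a) with hx
  set y := √(vR / b) with hy
  set p := √(cF * a) with hp
  set q := √(cR * b) with hq
  have hx2 : x ^ 2 = vF / a := Real.sq_sqrt (div_nonneg hvF ha.le)
  have hy2 : y ^ 2 = vR / b := Real.sq_sqrt (div_nonneg hvR hb.le)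
  have hp2 : p ^ 2 = cF * a := Real.sq_sqrt (by positivity)
  have hq2 : q ^ 2 = cR * b := Real.sq_sqrt (by positivity)
  have hxp : x * p = √(vF * cF) := by
    rw [hx, hp, ← Real.sqrt_mul (div_nonneg hvF ha.le)]
    congr 1
    field_simp
  have hyq : y * q = √(vR * cR) := by
    rw [hy, hq, ← Real.sqrt_mul (div_nonneg hvR hb.le)]
    congr 1
    field_simp
  rw [← hxp, ← hyq, ← hx2, ← hy2, ← hp2, ← hq2]
  nlinarith [sq_nonneg (x * q - y * p)]

/-- **Budgeted form**: if the two legs cost at most `C` (`c_F a + c_R b ≤ C`), then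
`(√(v_F c_F) + √(v_R c_R))²/C ≤ v_F/a + v_R/b`. -/
theorem div_add_div_ge_of_cost_le {vF vR cF cR a b C : ℝ} (hvF : 0 ≤ vF) (hvR : 0 ≤ vR)
    (hcF : 0 < cF) (hcR : 0 < cR) (ha : 0 < a) (hb : 0 < b) (hC : cF * a + cR * b ≤ C) :
    (√(vF * cF) + √(vR * cR)) ^ 2 / C ≤ vF / a + vR / b := by
  have hcost : 0 < cF * a + cR * b := by positivity
  have hCpos : 0 < C := lt_of_lt_of_le hcost hC
  have key := div_add_div_mul_cost_ge hvF hvR hcF hcR ha hb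
  have hV : 0 ≤ vF / a + vR / b := by positivity
  rw [div_le_iff₀ hCpos]
  calc (√(vF * cF) + √(vR * cR)) ^ 2 ≤ (vF / a + vR / b) * (cF * a + cR * b) := key
    _ ≤ (vF / a + vR / b) * C := mul_le_mul_of_nonneg_left hC hV

/-- **The floor is attained** by sampling each leg in proportion to `√(v/c)`: with
`a = t √(v_F/c_F)`, `b = t √(v_R/c_R)` (`t > 0`, `v_F, v_R > 0`),
`(v_F/a + v_R/b) · (c_F a + c_R b) = (√(v_F c_F) + √(v_R c_R))²`. -/
theorem div_add_div_eq_of_alloc {vF vR cF cR t : ℝ} (hvF : 0 < vF) (hvR : 0 < vR) (hcF : 0 < cF)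
    (hcR : 0 < cR) (ht : 0 < t) :
    (vF / (t * √(vF / cF)) + vR / (t * √(vR / cR))) * (cF * (t * √(vF / cF)) + cR * (t * √(vR / cR))) =
      (√(vF * cF) + √(vR * cR)) ^ 2 := by
  -- write everything through `sF = √v_F`, `sR = √v_R`, `kF = √c_F`, `kR = √c_R`
  have hsF : √vF ^ 2 = vF := Real.sq_sqrt hvF.le
  have hsR : √vR ^ 2 = vR := Real.sq_sqrt hvR.le
  have hkF : √cF ^ 2 = cF := Real.sq_sqrt hcF.le
  have hkR : √cR ^ 2 = cR := Real.sq_sqrt hcR.le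
  have hsF0 : 0 < √vF := Real.sqrt_pos.2 hvF
  have hsR0 : 0 < √vR := Real.sqrt_pos.2 hvR
  have hkF0 : 0 < √cF := Real.sqrt_pos.2 hcF
  have hkR0 : 0 < √cR := Real.sqrt_pos.2 hcR
  have h1 : √(vF / cF) = √vF / √cF := by rw [Real.sqrt_div' vF hcF.le]
  have h2 : √(vR / cR) = √vR / √cR := by rw [Real.sqrt_div' vR hcR.le]
  have h3 : √(vF * cF) = √vF * √cF := Real.sqrt_mul hvF.le cF
  have h4 : √(vR * cR) = √vR * √cR := Real.sqrt_mul hvR.le cR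
  rw [h1, h2, h3, h4, ← hsF, ← hsR, ← hkF, ← hkR]
  rw [Real.sqrt_sq hsF0.le, Real.sqrt_sq hsR0.le, Real.sqrt_sq hkF0.le, Real.sqrt_sq hkR0.le]
  field_simp

/-- **Equal costs**: for a budget of `a + b` evolutions per block,
`(√v_F + √v_R)² ≤ (v_F/a + v_R/b)(a + b)` — an equal split `a = b` can lose up to a factor `2`
against the optimal `a : b = √v_F : √v_R`. -/
theorem div_add_div_mul_add_ge {vF vR a b : ℝ} (hvF : 0 ≤ vF) (hvR : 0 ≤ vR) (ha : 0 < a)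
    (hb : 0 < b) : (√vF + √vR) ^ 2 ≤ (vF / a + vR / b) * (a + b) := by
  have key := div_add_div_mul_cost_ge hvF hvR one_pos one_pos ha hb
  simpa only [mul_one, one_mul] using key

end Summit.Ventures.LatticeQCDFlow.Exactness.GeneralNCMC
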